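import Summits.ABC.IUTFork.Repair.RHReachLedgerDoorGenuineUntied
import Summits.ABC.IUTFork.Repair.RHReachLedgerQ2Genuine
import HarnessLib

/-!
# R-H ROUND 2 Q2(27) — the last arrow WITHOUT the certificate binder: `LedgerAtDatum T ⟹ T.Cor312NonarchOf` and `K2Target27` on every
# Σ₂₇ datum whose bad primes have UNIFORM and UNTIED fibres (`e(𝔭_x∣p) = e(𝔭_w∣p)`, `(p−1) ∤ e`)

PROOF-ONLY file (0 definitions, 0 `Prop` facts; abc-iut cell, D-0079 RESCUE sub-cell R-H, rung LADDER-ABC:A2.RESCUE.H; ROUND-2 seat abc-iut-rh2-L1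
gen 2, row 27 «reach-ledger»). TAKES NO SIDE on [IUTchIII] Cor. 3.12 or on any author (Mochizuki / Scholze–Stix / Joshi / Dupuy–Hilado); typed ≠
proved; instantiated ≠ endorsed; nothing here asserts abc proved or refuted. Row 27's ledger (`RH.ReachLedger.HStarReachLedger(K)`,
abc-iut-lens-nearmiss-1, p464022; `LedgerAtDatum`, abc-iut-rh-typ-10 p468994) is an R-H CANDIDATE = a HYPOTHESIS SHAPE, never asserted.

abc-iut-rh-typ-10's last arrow `RH.ReachLedgerQ2.cor312NonarchOf_of_ledgerAtDatum` / `k2Target27_of_certificates` (`Repair/RHReachLedgerQ2Genuine.lean`)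
takes per datum a CERTIFIED UNIFORM DICTIONARY AT EVERY PRIME (`e_p`, a NON-log-unit at `A_p`, a log-unit at `B_p ≤ A_p` at every `x ∣ p`,
column domination at the bad places). THIS FILE replaces that binder by the two structural conditions under which it is a THEOREM
(`ReachLedgerDoor.statement_pilotDataOfK_of_hStarReachLedgerK_untied'`, `Repair/RHReachLedgerDoorGenuineUntied.lean`: W-relative door +
`LogEnvelope.not_closedBall_div_subset_logUnits` + `RHSlotReach.exists_hrad_sharp` + `envelope_le_rOutSharp`): at every prime `p` UNDER A BAD PLACE
of the datum's `K`, (U) the fibre is UNIFORM — `e(𝔭_x ∣ p) = e(𝔭_w ∣ p)` for all `x ∣ p` (automatic for `K/ℚ` Galois: HEX, G-HEX, lamSeven, frey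
rows) — and (T) UNTIED — `(p−1) ∤ e(𝔭_w ∣ p)` (in particular no bad place over `2`). PROVED:
* `cor312NonarchOf_of_ledgerAtDatum_untied` — «`LedgerAtDatum T` ∧ (U) ∧ (T) ⟹ `T.Cor312NonarchOf`» at the CHOSEN realising ideles (typ-10's
  composition verbatim: `Cor312Prov.exists_realising_{q,theta}Ideles_pilotDataOfK`, `exists_nat_qPilot_pilotDataOfK`,
  `ledgerAtDatum_iff_hStarReachLedgerK`, abc-iut-s2-p10's `GenuineKStatement.statement_chosen_iff_cor312NonarchOf`);
* **`k2Target27_of_untied`** — `K2Target27` FOLLOWS from «every Σ₂₇ datum (antecedents of `K2Target27` VERBATIM) satisfies (U) ∧ (T) at its bad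
  primes» — explicit 1, no witness data. With `abc_of_k2Target27_of_hStar27OnSigma27` (p468994): H⋆₂₇|Σ₂₇ ∧ (U,T)|Σ₂₇ ∧ NUM(deep ∧ bad) ∧ CONE ⟹ `ABC`,
  as typed implications (R14: the CONE binder of that composition is the blanket one — a composition RECORD, the recut is the C lane's).
HONEST SCOPE. `K2Target27` stays OPEN as typed exactly at Σ₂₇ data with a non-uniform or TIED bad prime (`(p−1) ∣ e_w`: HEX `p = 7`, `e_w ∈ {6,12,…}`;
every place over `2`); the tie literature (`UnitLogInnerRadiusTie*`, `UnitLogTieAttained`) is the door for those. OUR typed objects throughout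
(Dupuy–Hilado (Ind2) = all `ℤ_p`-lattice automorphisms, STRONGER-THAN-PRINT; sharp boxes; volume reading of Step (xi)); which genuine data satisfy
H⋆₂₇ is abc-iut-rh-num-1's table, not this file. [cite: NeukirchANT1999, Ch. II (5.5)] [cite: DupuyHilado2025, §1 (1.1), §3.4, §3.9, §4.9]
[cite: Mochizuki2012, IUTchI Ex. 3.2 (iv) p. 71; IUTchIII Cor. 3.12 p. 173–174; Rmk. 3.9.3 pp. 119–120] [claim: Mochizuki2012, status: disputed]
-/

noncomputable section

open Set Function NumberField IsDedekindDomain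

namespace Summit.ABC.IUTFork.Repair.RH.ReachLedgerQ2

open Thm311 Thm311.Real Cor312 Cor312Vol Cor312Prov Literature.IUT.LogThetaLattice Literature.IUT.LogVolume
  Literature.IUT.HodgeTheaters Literature.IUT.LogVolume.ThetaData Summit.ABC.IUTFork.Repair.RH.ReachLedger
  Summit.ABC.IUTFork.Repair.RH.ReachLedgerDoor
open Literature.NumberTheory.DiophantineGeometry Literature.NumberTheory.DiophantineGeometry.GenEll Summit.ABC.ABC.Theorems
  Summit.ABC.IUTFork.Conditional
open scoped Classical

/-! ## §0. (U) is a theorem for `F/ℚ` Galois: the ramification index is constant on the fibre over `p` -/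

section Galois

variable {F : Type} [Field F] [NumberField F] (X : PilotData F)

/-- **UNIFORM FIBRES FOR `F/ℚ` GALOIS**: `e(𝔭_x ∣ p) = e(𝔭_w ∣ p)` for any two fibre points `x, w ∣ p` of a pilot datum over a number field
`F` Galois over `ℚ` (`Gal(F/ℚ)` is transitive on the primes over `p`; Mathlib `Ideal.ramificationIdx_eq_of_isGaloisGroup`). So hypothesis (U) of
this file is discharged on the `K/ℚ`-Galois rows. [cite: NeukirchANT1999, Ch. I §9 (9.1), Ch. II Prop. (6.8)] -/
theorem ramificationIdx_placeOf_eq_of_isGalois [IsGalois ℚ F] (pp : Nat.Primes) (w x : (thetaIndex X).Fibre (.inr pp)) :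
    haveI : Fact (pp : ℕ).Prime := ⟨pp.2⟩
    (placeOf X pp.1 x).asIdeal.ramificationIdx ℤ = (placeOf X pp.1 w).asIdeal.ramificationIdx ℤ := by
  haveI : Fact (pp : ℕ).Prime := ⟨pp.2⟩
  haveI : (placeOf X pp.1 x).asIdeal.IsPrime := (placeOf X pp.1 x).isPrime
  haveI : (placeOf X pp.1 w).asIdeal.IsPrime := (placeOf X pp.1 w).isPrime
  haveI := liesOver_span_of_natCast_mem F pp.1 (placeOf X pp.1 x) (natCast_mem_placeOf X pp.1 x)
  haveI := liesOver_span_of_natCast_mem F pp.1 (placeOf X pp.1 w) (natCast_mem_placeOf X pp.1 w)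
  exact Ideal.ramificationIdx_eq_of_isGaloisGroup (Ideal.span {((pp : ℕ) : ℤ)}) (placeOf X pp.1 x).asIdeal
    (placeOf X pp.1 w).asIdeal (F ≃ₐ[ℚ] F)

end Galois

section KFamily

variable
    (M : ∀ (P : NFPoint) (l : ℕ) (T : Cor22.ThetaVolumeDatumAt P l), Type) [∀ P l T, Field (M P l T)] [∀ P l T, NumberField (M P l T)]
    (archPk : ∀ (P : NFPoint) (l : ℕ) (T : Cor22.ThetaVolumeDatumAt P l), letI := T.instFieldF; letI := T.instNumberFieldF; letI := T.instAlgebraF; letI := T.instFieldK;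
        letI := T.instNumberFieldK; letI := T.instAlgebraK; letI := T.instFieldFbar; letI := T.instAlgebraFbar;
        letI := T.instAlgebraKFbar; letI := T.instIsElliptic;
      ∀ (j : (thetaIndex (pilotDataOfK T.D T.K)).Label) (vQ : (thetaIndex (pilotDataOfK T.D T.K)).VQ), Set ((logShellsDH (pilotDataOfK T.D T.K) (analyticLogv T.K)).Packet j vQ))
    (archSub : ∀ (P : NFPoint) (l : ℕ) (T : Cor22.ThetaVolumeDatumAt P l), letI := T.instFieldF; letI := T.instNumberFieldF; letI := T.instAlgebraF; letI := T.instFieldK;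
        letI := T.instNumberFieldK; letI := T.instAlgebraK; letI := T.instFieldFbar; letI := T.instAlgebraFbar;
        letI := T.instAlgebraKFbar; letI := T.instIsElliptic;
      ∀ (j : (thetaIndex (pilotDataOfK T.D T.K)).Label) (v : (thetaIndex (pilotDataOfK T.D T.K)).V), Set ((logShellsDH (pilotDataOfK T.D T.K) (analyticLogv T.K)).Packet j ((thetaIndex (pilotDataOfK T.D T.K)).over v)))
    (Ψ : ∀ (P : NFPoint) (l : ℕ) (T : Cor22.ThetaVolumeDatumAt P l), letI := T.instFieldF; letI := T.instNumberFieldF; letI := T.instAlgebraF; letI := T.instFieldK;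
        letI := T.instNumberFieldK; letI := T.instAlgebraK; letI := T.instFieldFbar; letI := T.instAlgebraFbar;
        letI := T.instAlgebraKFbar; letI := T.instIsElliptic;
      ℤ → ∀ v : (thetaIndex (pilotDataOfK T.D T.K)).V, v ∈ (thetaIndex (pilotDataOfK T.D T.K)).Vbad → Set ((logShellsDH (pilotDataOfK T.D T.K) (analyticLogv T.K)).StarPacket v))
    (act : ∀ (P : NFPoint) (l : ℕ) (T : Cor22.ThetaVolumeDatumAt P l), letI := T.instFieldF; letI := T.instNumberFieldF; letI := T.instAlgebraF; letI := T.instFieldK;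
        letI := T.instNumberFieldK; letI := T.instAlgebraK; letI := T.instFieldFbar; letI := T.instAlgebraFbar;
        letI := T.instAlgebraKFbar; letI := T.instIsElliptic;
      ℤ → ∀ v : (thetaIndex (pilotDataOfK T.D T.K)).V, v ∈ (thetaIndex (pilotDataOfK T.D T.K)).Vbad → (logShellsDH (pilotDataOfK T.D T.K) (analyticLogv T.K)).StarPacket v → Module.End ℚ ((logShellsDH (pilotDataOfK T.D T.K) (analyticLogv T.K)).StarPacket v))
    (Mmod : ∀ (P : NFPoint) (l : ℕ) (T : Cor22.ThetaVolumeDatumAt P l), letI := T.instFieldF; letI := T.instNumberFieldF; letI := T.instAlgebraF; letI := T.instFieldK;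
        letI := T.instNumberFieldK; letI := T.instAlgebraK; letI := T.instFieldFbar; letI := T.instAlgebraFbar;
        letI := T.instAlgebraKFbar; letI := T.instIsElliptic;
      ℤ → ∀ j : (thetaIndex (pilotDataOfK T.D T.K)).LabelStar, Set ((logShellsDH (pilotDataOfK T.D T.K) (analyticLogv T.K)).GlobalPacket j.1))
    (region : ∀ (P : NFPoint) (l : ℕ) (T : Cor22.ThetaVolumeDatumAt P l), letI := T.instFieldF; letI := T.instNumberFieldF; letI := T.instAlgebraF; letI := T.instFieldK;
        letI := T.instNumberFieldK; letI := T.instAlgebraK; letI := T.instFieldFbar; letI := T.instAlgebraFbar;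
        letI := T.instAlgebraKFbar; letI := T.instIsElliptic;
      ℤ → ∀ j : (thetaIndex (pilotDataOfK T.D T.K)).LabelStar, FinDivisor (M P l T) → ∀ vQ : (thetaIndex (pilotDataOfK T.D T.K)).VQ, Set ((logShellsDH (pilotDataOfK T.D T.K) (analyticLogv T.K)).Packet j.1 vQ))
    (n : ∀ (P : NFPoint) (l : ℕ) (T : Cor22.ThetaVolumeDatumAt P l), ℤ)
    {HT : ∀ (P : NFPoint) (l : ℕ) (T : Cor22.ThetaVolumeDatumAt P l), Type} {LogLink : ∀ (P : NFPoint) (l : ℕ) (T : Cor22.ThetaVolumeDatumAt P l), HT P l T → HT P l T → Type}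
    {IsFull : ∀ (P : NFPoint) (l : ℕ) (T : Cor22.ThetaVolumeDatumAt P l), ∀ {s t : HT P l T}, LogLink P l T s t → Prop}
    (lat : ∀ (P : NFPoint) (l : ℕ) (T : Cor22.ThetaVolumeDatumAt P l), LGPGaussianLogThetaLattice (LogLink P l T) (IsFull P l T))
    {Frd : ∀ (P : NFPoint) (l : ℕ) (T : Cor22.ThetaVolumeDatumAt P l), Type} {IsoF : ∀ (P : NFPoint) (l : ℕ) (T : Cor22.ThetaVolumeDatumAt P l), Frd P l T → Frd P l T → Type} {Ob : ∀ (P : NFPoint) (l : ℕ) (T : Cor22.ThetaVolumeDatumAt P l), Frd P l T → Type}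
    {realify : ∀ (P : NFPoint) (l : ℕ) (T : Cor22.ThetaVolumeDatumAt P l), Frd P l T → Frd P l T} {Strip : ∀ (P : NFPoint) (l : ℕ) (T : Cor22.ThetaVolumeDatumAt P l), Type} {IsoS : ∀ (P : NFPoint) (l : ℕ) (T : Cor22.ThetaVolumeDatumAt P l), Strip P l T → Strip P l T → Type}
    {Mv : ∀ (P : NFPoint) (l : ℕ) (T : Cor22.ThetaVolumeDatumAt P l), letI := T.instFieldF; letI := T.instNumberFieldF; letI := T.instAlgebraF; letI := T.instFieldK;
        letI := T.instNumberFieldK; letI := T.instAlgebraK; letI := T.instFieldFbar; letI := T.instAlgebraFbar;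
        letI := T.instAlgebraKFbar; letI := T.instIsElliptic;
      ∀ v : (thetaIndex (pilotDataOfK T.D T.K)).V, v ∈ (thetaIndex (pilotDataOfK T.D T.K)).Vbad → Type}
    [∀ P l T v h, Monoid (Mv P l T v h)]
    (sig : ∀ (P : NFPoint) (l : ℕ) (T : Cor22.ThetaVolumeDatumAt P l), letI := T.instFieldF; letI := T.instNumberFieldF; letI := T.instAlgebraF; letI := T.instFieldK;
        letI := T.instNumberFieldK; letI := T.instAlgebraK; letI := T.instFieldFbar; letI := T.instAlgebraFbar;
        letI := T.instAlgebraKFbar; letI := T.instIsElliptic;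
      GlobalLGPFrobenioidSignature (thetaIndex (pilotDataOfK T.D T.K)).lstar (thetaIndex (pilotDataOfK T.D T.K)).V (· ∈ (thetaIndex (pilotDataOfK T.D T.K)).Vbad) (Frd P l T) (IsoF P l T) (Ob P l T) (realify P l T)
        (Strip P l T) (IsoS P l T) (Mv P l T))
    (split : ∀ (P : NFPoint) (l : ℕ) (T : Cor22.ThetaVolumeDatumAt P l), SplittingMonoids (Mv P l T))
    {ObΔ : ∀ (P : NFPoint) (l : ℕ) (T : Cor22.ThetaVolumeDatumAt P l), Type} {N : ∀ (P : NFPoint) (l : ℕ) (T : Cor22.ThetaVolumeDatumAt P l), letI := T.instFieldF; letI := T.instNumberFieldF; letI := T.instAlgebraF; letI := T.instFieldK;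
        letI := T.instNumberFieldK; letI := T.instAlgebraK; letI := T.instFieldFbar; letI := T.instAlgebraFbar;
        letI := T.instAlgebraKFbar; letI := T.instIsElliptic;
      ∀ v : (thetaIndex (pilotDataOfK T.D T.K)).V, v ∈ (thetaIndex (pilotDataOfK T.D T.K)).Vbad → Type}
    [∀ P l T v h, Monoid (N P l T v h)] (qData : ∀ (P : NFPoint) (l : ℕ) (T : Cor22.ThetaVolumeDatumAt P l), QPilotData (ObΔ P l T) (N P l T))


include M archPk archSub Ψ act Mmod region n lat sig split qData in
/-- **`LedgerAtDatum T ⟹ T.Cor312NonarchOf` WITHOUT CERTIFICATE DATA** (per datum; every context of abc-iut-c312-7's sharp `K`-setting as binders).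
At a Θ-volume datum `T` whose field `K = T.K` has, at every prime `p` UNDER A BAD PLACE, a UNIFORM fibre (`e(𝔭_x ∣ p) = e(𝔭_w ∣ p)` for every `x ∣ p`,
`w` bad) off the inner tie (`(p−1) ∤ e(𝔭_w ∣ p)`): row 27's ledger at the datum, `LedgerAtDatum T` (p468994), implies the NUMBER-level [IUTchIII]
Cor. 3.12 `T.Cor312NonarchOf` — abc-iut-rh2-L1's `ReachLedgerDoor.statement_pilotDataOfK_of_hStarReachLedgerK_untied'` (certificates discharged in
kernel) at the CHOSEN realising ideles, composed exactly as abc-iut-rh-typ-10's `cor312NonarchOf_of_ledgerAtDatum`. H⋆₂₇ is a HYPOTHESIS; no side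
taken on [IUTchIII] Cor. 3.12. [cite: NeukirchANT1999, Ch. II (5.5)] [cite: Mochizuki2012, IUTchI Ex. 3.2 (iv) p. 71; IUTchIII Cor. 3.12 p. 173–174]
[cite: DupuyHilado2025, §1 (1.1), §3.4, §3.9, §4.9] [claim: Mochizuki2012, status: disputed] -/
theorem cor312NonarchOf_of_ledgerAtDatum_untied {P : NFPoint} {l : ℕ} (T : Cor22.ThetaVolumeDatumAt P l)
    (huni : letI := T.instFieldF; letI := T.instNumberFieldF; letI := T.instAlgebraF; letI := T.instFieldK;
        letI := T.instNumberFieldK; letI := T.instAlgebraK; letI := T.instFieldFbar; letI := T.instAlgebraFbar;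
        letI := T.instAlgebraKFbar; letI := T.instIsElliptic;
      ∀ (pp : Nat.Primes) (w x : (thetaIndex (pilotDataOfK T.D T.K)).Fibre (.inr pp)), haveI : Fact (pp : ℕ).Prime := ⟨pp.2⟩
        placeOf (pilotDataOfK T.D T.K) pp.1 w ∈ (pilotDataOfK T.D T.K).S →
          (placeOf (pilotDataOfK T.D T.K) pp.1 x).asIdeal.ramificationIdx ℤ = (placeOf (pilotDataOfK T.D T.K) pp.1 w).asIdeal.ramificationIdx ℤ)
    (hnd : letI := T.instFieldF; letI := T.instNumberFieldF; letI := T.instAlgebraF; letI := T.instFieldK;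
        letI := T.instNumberFieldK; letI := T.instAlgebraK; letI := T.instFieldFbar; letI := T.instAlgebraFbar;
        letI := T.instAlgebraKFbar; letI := T.instIsElliptic;
      ∀ (pp : Nat.Primes) (w : (thetaIndex (pilotDataOfK T.D T.K)).Fibre (.inr pp)), haveI : Fact (pp : ℕ).Prime := ⟨pp.2⟩
        placeOf (pilotDataOfK T.D T.K) pp.1 w ∈ (pilotDataOfK T.D T.K).S →
          ¬ ((pp : ℕ) - 1 ∣ (placeOf (pilotDataOfK T.D T.K) pp.1 w).asIdeal.ramificationIdx ℤ))
    (hL : LedgerAtDatum T) :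
    T.Cor312NonarchOf := by
  letI := T.instFieldF; letI := T.instNumberFieldF; letI := T.instAlgebraF; letI := T.instFieldK
  letI := T.instNumberFieldK; letI := T.instAlgebraK; letI := T.instFieldFbar; letI := T.instAlgebraFbar
  letI := T.instAlgebraKFbar; letI := T.instIsElliptic
  haveI hne : ∀ pp : Nat.Primes, Fact (pp : ℕ).Prime := fun pp => ⟨pp.2⟩
  -- the q-pilot degrees are naturals (`P_w ≥ 1` on `S`, `0` off `S`)
  have hPex : ∀ (pp : Nat.Primes) (w : (thetaIndex (pilotDataOfK T.D T.K)).Fibre (.inr pp)),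
      ∃ Pw : ℕ, (pilotDataOfK T.D T.K).qPilot (placeOf (pilotDataOfK T.D T.K) pp.1 w) = Pw := by
    intro pp w
    by_cases hw : placeOf (pilotDataOfK T.D T.K) pp.1 w ∈ (pilotDataOfK T.D T.K).S
    · obtain ⟨Pw, hPw, -⟩ := exists_nat_qPilot_pilotDataOfK T.D hw
      exact ⟨Pw, hPw⟩
    · exact ⟨0, by rw [PilotData.qPilot_apply_of_not_mem (pilotDataOfK T.D T.K) hw, Nat.cast_zero]⟩
  choose Pw hPw using hPex
  have hH : HStarReachLedgerK T.D
      (fun pp w => (placeOf (pilotDataOfK T.D T.K) pp.1 w).asIdeal.ramificationIdx ℤ) (fun pp w => (Pw pp w : ℤ)) :=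
    (ledgerAtDatum_iff_hStarReachLedgerK T Pw hPw).1 hL
  have hst := statement_pilotDataOfK_of_hStarReachLedgerK_untied' T.D (logvAnalytic_analyticLogv (F := T.K)) (M P l T)
    (archPk P l T) (archSub P l T) (Ψ P l T) (act P l T) (Mmod P l T) (region P l T) (n P l T) (lat P l T) (sig P l T) (split P l T)
    (qData P l T) (exists_realising_qIdeles_pilotDataOfK T.D).choose (exists_realising_thetaIdeles_pilotDataOfK T.D).choose
    (exists_realising_qIdeles_pilotDataOfK T.D).choose_spec.1 (exists_realising_qIdeles_pilotDataOfK T.D).choose_spec.2.1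
    (exists_realising_thetaIdeles_pilotDataOfK T.D).choose_spec.1 (exists_realising_thetaIdeles_pilotDataOfK T.D).choose_spec.2.1
    (exists_realising_thetaIdeles_pilotDataOfK T.D).choose_spec.2.2 (exists_realising_qIdeles_pilotDataOfK T.D).choose_spec.2.2
    (fun pp w => (Pw pp w : ℤ)) huni hnd (fun pp w _ => by rw [Int.cast_natCast]; exact (hPw pp w).symm) hH
  exact (GenuineKStatement.statement_chosen_iff_cor312NonarchOf M archPk archSub Ψ act Mmod region n lat sig split qData T).1 hst

include M archPk archSub Ψ act Mmod region n lat sig split qData in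
/-- **`K2Target27` WITHOUT CERTIFICATE DATA — row 27's first arrow «S|Σ₂₇ ⇒ Cor 3.12|Σ₂₇» FOLLOWS from ONE structural hypothesis: every Σ₂₇ datum
(admissible SZPIRO-BAD `(P, l)`, datum OFF the depth locus — the antecedents of `K2Target27` VERBATIM) has UNIFORM and UNTIED fibres at its bad
primes** (`e(𝔭_x ∣ p) = e(𝔭_w ∣ p)` for `x ∣ p`, `w` bad; `(p−1) ∤ e(𝔭_w ∣ p)`). Explicit 1, NO witness data: the inner/outer certificates and the
column domination of abc-iut-rh-typ-10's `k2Target27_of_certificates` are theorems under it. Then `abc_of_k2Target27_of_hStar27OnSigma27` (p468994)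
reads: H⋆₂₇|Σ₂₇ ∧ (U,T)|Σ₂₇ ∧ NUM(deep ∧ bad) ∧ CONE ⟹ `ABC`, as typed implications. (U) holds on the `K/ℚ`-Galois rows; (T) fails exactly at the
TIED bad primes (`(p−1) ∣ e_w`, every place over `2`) — there `K2Target27` stays OPEN as typed. No side taken on [IUTchIII] Cor. 3.12; nothing asserts
abc. [cite: NeukirchANT1999, Ch. II (5.5)] [claim: Mochizuki2012, status: disputed] -/
theorem k2Target27_of_untied
    (hUT : ∀ (P : NFPoint), P ∈ UP → ∀ (l : ℕ), l.Prime → 5 ≤ l →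
      Cor22.AdmitsCore P → Cor22.CondP2 P l → Cor22.CondP5 P l → Cor22.CondP6 P l →
      (((l : ℝ) + 5) / 4 < (Cor22.dmod P : ℝ) ∨
        6 * l * (((l : ℝ) + 5) - 4 * Cor22.dmod P) / (((l : ℝ) + 4) * ((l : ℝ) - 3))
            * (P.logDiff + (1 - 1 / (l : ℝ)) * Cor22.logCondAvoid P {2, l})
          + 6 * l * ((l : ℝ) + 5) / (((l : ℝ) + 4) * ((l : ℝ) - 3)) * Real.log Real.pi < Cor22.logQAvoid P {2, l}) →
      ∀ (T : Cor22.ThetaVolumeDatumAt P l), letI := T.instFieldF; letI := T.instNumberFieldF; letI := T.instAlgebraF; letI := T.instFieldK;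
        letI := T.instNumberFieldK; letI := T.instAlgebraK; letI := T.instFieldFbar; letI := T.instAlgebraFbar;
        letI := T.instAlgebraKFbar; letI := T.instIsElliptic;
      ¬ (∃ (pp : Nat.Primes) (_ : 2 < (pp : ℕ)) (i : Fin (thetaIndex (pilotDataOfK T.D T.K)).lstar)
          (x₀ : (thetaIndex (pilotDataOfK T.D T.K)).Fibre (.inr pp)),
        haveI : Fact (pp : ℕ).Prime := ⟨pp.2⟩
        ((pp : ℕ) : ℝ) ^ ((((i : ℕ) : ℝ) + 2) * (4 + 2 * Real.logb (pp : ℕ) (Module.finrank ℚ T.K)) + 1) *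
          ‖(exists_realising_qIdeles_pilotDataOfK T.D).choose pp x₀‖ ^ (((i : ℕ) + 1) ^ 2 - 1) < 1) →
      (∀ (pp : Nat.Primes) (w x : (thetaIndex (pilotDataOfK T.D T.K)).Fibre (.inr pp)), haveI : Fact (pp : ℕ).Prime := ⟨pp.2⟩
          placeOf (pilotDataOfK T.D T.K) pp.1 w ∈ (pilotDataOfK T.D T.K).S →
            (placeOf (pilotDataOfK T.D T.K) pp.1 x).asIdeal.ramificationIdx ℤ =
              (placeOf (pilotDataOfK T.D T.K) pp.1 w).asIdeal.ramificationIdx ℤ) ∧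
        (∀ (pp : Nat.Primes) (w : (thetaIndex (pilotDataOfK T.D T.K)).Fibre (.inr pp)), haveI : Fact (pp : ℕ).Prime := ⟨pp.2⟩
          placeOf (pilotDataOfK T.D T.K) pp.1 w ∈ (pilotDataOfK T.D T.K).S →
            ¬ ((pp : ℕ) - 1 ∣ (placeOf (pilotDataOfK T.D T.K) pp.1 w).asIdeal.ramificationIdx ℤ))) :
    K2Target27 := by
  intro P hP l hl h5 hc h2 h5' h6 hbad T hwin hL
  obtain ⟨huni, hnd⟩ := hUT P hP l hl h5 hc h2 h5' h6 hbad T hwin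
  exact cor312NonarchOf_of_ledgerAtDatum_untied M archPk archSub Ψ act Mmod region n lat sig split qData T huni hnd hL

include M archPk archSub Ψ act Mmod region n lat sig split qData in
/-- **`K/ℚ` GALOIS rows: `LedgerAtDatum T` ∧ (T) ⟹ `T.Cor312NonarchOf`** — (U) discharged by `ramificationIdx_placeOf_eq_of_isGalois` (§0); left:
the bad primes are UNTIED, `(p−1) ∤ e(𝔭_w ∣ p)`. [cite: NeukirchANT1999, Ch. I §9 (9.1), Ch. II (5.5)] [claim: Mochizuki2012, status: disputed] -/
theorem cor312NonarchOf_of_ledgerAtDatum_untied_of_isGalois {P : NFPoint} {l : ℕ} (T : Cor22.ThetaVolumeDatumAt P l)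
    (hgal : letI := T.instFieldF; letI := T.instNumberFieldF; letI := T.instAlgebraF; letI := T.instFieldK;
        letI := T.instNumberFieldK; letI := T.instAlgebraK; letI := T.instFieldFbar; letI := T.instAlgebraFbar;
        letI := T.instAlgebraKFbar; letI := T.instIsElliptic; IsGalois ℚ T.K)
    (hnd : letI := T.instFieldF; letI := T.instNumberFieldF; letI := T.instAlgebraF; letI := T.instFieldK;
        letI := T.instNumberFieldK; letI := T.instAlgebraK; letI := T.instFieldFbar; letI := T.instAlgebraFbar;
        letI := T.instAlgebraKFbar; letI := T.instIsElliptic;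
      ∀ (pp : Nat.Primes) (w : (thetaIndex (pilotDataOfK T.D T.K)).Fibre (.inr pp)), haveI : Fact (pp : ℕ).Prime := ⟨pp.2⟩
        placeOf (pilotDataOfK T.D T.K) pp.1 w ∈ (pilotDataOfK T.D T.K).S →
          ¬ ((pp : ℕ) - 1 ∣ (placeOf (pilotDataOfK T.D T.K) pp.1 w).asIdeal.ramificationIdx ℤ))
    (hL : LedgerAtDatum T) :
    T.Cor312NonarchOf := by
  letI := T.instFieldF; letI := T.instNumberFieldF; letI := T.instAlgebraF; letI := T.instFieldK
  letI := T.instNumberFieldK; letI := T.instAlgebraK; letI := T.instFieldFbar; letI := T.instAlgebraFbar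
  letI := T.instAlgebraKFbar; letI := T.instIsElliptic
  haveI := hgal
  exact cor312NonarchOf_of_ledgerAtDatum_untied M archPk archSub Ψ act Mmod region n lat sig split qData T
    (fun pp w x _ => ramificationIdx_placeOf_eq_of_isGalois (pilotDataOfK T.D T.K) pp w x) hnd hL

include M archPk archSub Ψ act Mmod region n lat sig split qData in
/-- **`K2Target27` on the `K/ℚ`-GALOIS, UNTIED stratum** — from ONE hypothesis: every Σ₂₇ datum has `K/ℚ` Galois and untied bad primes.
Explicit 1, no witness data; (U) is §0. [cite: NeukirchANT1999, Ch. I §9 (9.1), Ch. II (5.5)] [claim: Mochizuki2012, status: disputed] -/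
theorem k2Target27_of_isGalois_untied
    (hGT : ∀ (P : NFPoint), P ∈ UP → ∀ (l : ℕ), l.Prime → 5 ≤ l →
      Cor22.AdmitsCore P → Cor22.CondP2 P l → Cor22.CondP5 P l → Cor22.CondP6 P l →
      (((l : ℝ) + 5) / 4 < (Cor22.dmod P : ℝ) ∨
        6 * l * (((l : ℝ) + 5) - 4 * Cor22.dmod P) / (((l : ℝ) + 4) * ((l : ℝ) - 3))
            * (P.logDiff + (1 - 1 / (l : ℝ)) * Cor22.logCondAvoid P {2, l})
          + 6 * l * ((l : ℝ) + 5) / (((l : ℝ) + 4) * ((l : ℝ) - 3)) * Real.log Real.pi < Cor22.logQAvoid P {2, l}) →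
      ∀ (T : Cor22.ThetaVolumeDatumAt P l), letI := T.instFieldF; letI := T.instNumberFieldF; letI := T.instAlgebraF; letI := T.instFieldK;
        letI := T.instNumberFieldK; letI := T.instAlgebraK; letI := T.instFieldFbar; letI := T.instAlgebraFbar;
        letI := T.instAlgebraKFbar; letI := T.instIsElliptic;
      ¬ (∃ (pp : Nat.Primes) (_ : 2 < (pp : ℕ)) (i : Fin (thetaIndex (pilotDataOfK T.D T.K)).lstar)
          (x₀ : (thetaIndex (pilotDataOfK T.D T.K)).Fibre (.inr pp)),
        haveI : Fact (pp : ℕ).Prime := ⟨pp.2⟩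
        ((pp : ℕ) : ℝ) ^ ((((i : ℕ) : ℝ) + 2) * (4 + 2 * Real.logb (pp : ℕ) (Module.finrank ℚ T.K)) + 1) *
          ‖(exists_realising_qIdeles_pilotDataOfK T.D).choose pp x₀‖ ^ (((i : ℕ) + 1) ^ 2 - 1) < 1) →
      IsGalois ℚ T.K ∧
        (∀ (pp : Nat.Primes) (w : (thetaIndex (pilotDataOfK T.D T.K)).Fibre (.inr pp)), haveI : Fact (pp : ℕ).Prime := ⟨pp.2⟩
          placeOf (pilotDataOfK T.D T.K) pp.1 w ∈ (pilotDataOfK T.D T.K).S →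
            ¬ ((pp : ℕ) - 1 ∣ (placeOf (pilotDataOfK T.D T.K) pp.1 w).asIdeal.ramificationIdx ℤ))) :
    K2Target27 := by
  intro P hP l hl h5 hc h2 h5' h6 hbad T hwin hL
  obtain ⟨hgal, hnd⟩ := hGT P hP l hl h5 hc h2 h5' h6 hbad T hwin
  exact cor312NonarchOf_of_ledgerAtDatum_untied_of_isGalois M archPk archSub Ψ act Mmod region n lat sig split qData T hgal hnd hL

end KFamily

end Summit.ABC.IUTFork.Repair.RH.ReachLedgerQ2

end
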